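import Mathlib.MeasureTheory.Function.LpSpace.Basic
import Mathlib.MeasureTheory.Integral.IntervalIntegral.Basic
import Literature.NumberTheory.LFunctions.ZetaScrew
import Literature.NumberTheory.LFunctions.WeilExplicit
import HarnessLib

/-!
# Suzuki's hermitian forms `⟨·,·⟩_{G_g,a}` of the screw function of `ζ` — STATEMENTS

LINE 1 — LABEL: RH-FREE corpus literature (definitions of the printed objects; the printed theorems
as NAMED FACTS `def … : Prop`, nothing asserted). `Suzuki2023_thm13` and `Suzuki2023_thm14` are
RH-EQUIVALENT criteria ON THEIR LINE 1 (both directions printed and proved in the source); they are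
Weil's / Yoshida's positivity criteria RE-INDEXED through the differentiation bijection `D`
(Prop. 3.1 = `Suzuki2023_prop31`), i.e. the COLUMN-2 objects `WeilPositivityOn`,
`riemannHypothesis_iff_forall_weilPositivityOn` of the tree in another coordinate — typing them
fixes WHICH positivity would prove RH; it does not move RH. `Suzuki2023_thm14_eigenvalue`,
`Suzuki2023_lemma21`, `Suzuki2023_prop31` are RH-FREE. WHAT THIS IS NOT: not a route, not a proof
plan for RH, no positivity is asserted; nothing here bears on the truth of RH.

Source: M. Suzuki, *Aspects of the screw function corresponding to the Riemann zeta-function*,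
J. Lond. Math. Soc. (2) 108 (2023) 1448–1487 = arXiv:2206.03682v4 [bib: `Suzuki2023`]; locators
`pNNNN:Lnn` are chunk:line of the held text `paper:arxiv-2206.03682` (TeX numbering = journal
numbering). This module types §1 eqs. (1.10)–(1.12) and Thms. 1.3, 1.4, §2.4 Lemma 2.1, §3.2–3.3
eqs. (3.3), (3.6), (3.7) and Prop. 3.1 (Thm. 1.5 — trace class — and the trace formula displayed
after it are the sibling module `ZetaScrewTraceClass.lean`, which alone carries the operator-theory
import of the tree's `IsTraceClass`), over the
tree's screw-function vocabulary of `ZetaScrew.lean` (COLUMN 1: `zetaScrew = Ψ = −g`,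
`zetaScrewKernel = G_g`, eq. (1.4)) and Weil vocabulary of `WeilExplicit.lean` (COLUMN 2:
`IsWeilTest`, `weilConv`, `weilReflect`, `weilMellin`, `HasWeilZeroSide`, `weilFunctional`).

## What is printed, and how it is typed

* (1.10) p0003:L38–44: for `0 < a ≤ ∞` and functions supported in `[−a,a]`,
  `⟨φ₁,φ₂⟩_{G_g,a} := ∫_{−a}^{a}∫_{−a}^{a} G_g(t,u) φ₁(u) conj φ₂(t) du dt` "when the right-hand side
  is absolutely convergent" — `zetaScrewForm S φ₁ φ₂` with the integration window a SET `S`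
  (`S = Ioo (−a) a` below; `S = univ` is the form `⟨·,·⟩_{G_g}` on `C_c^∞(ℝ)` of the companion paper
  arXiv:2209.04658 (1.15), so that module can cite this def). Bochner integrals: junk `0` when not
  integrable; every statement below uses it only where the source's integrals converge absolutely
  (continuous kernel on a bounded square against `L²` ⊂ `L¹` functions).
* (1.11) p0003:L48: `𝔈₀(a) := {φ ∈ C_c^∞(ℝ) : supp φ ⊆ [−a,a], ∫_{−a}^{a} φ = 0}` — `screwTestC0 a`
  (`C_c^∞` = the tree's `IsWeilTest`; the mean is written `∫_ℝ φ`, equal to `∫_{−a}^{a} φ` for such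
  `φ`). (3.6) p0007:L95: `C(a) := {ψ ∈ C_c^∞(ℝ) : supp ψ ⊆ [−a,a]}` — `screwTestC a`, literally the
  test class of `WeilPositivityOn a`.
* (1.12) p0003:L83–86: `𝖦_g[a] : φ ↦ 𝟏_{[−a,a]}(t) ∫_{−a}^{a} G_g(t,u) φ(u) du` on `L²(−a,a)` —
  `zetaScrewOp S φ` at the level of functions `ℝ → ℂ` (indicator of the window times the integral);
  `L²(−a,a)` is Mathlib's `Lp ℂ 2 (volume.restrict (Ioo (−a) a))`, whose elements coerce to
  a.e.-defined functions `ℝ → ℂ`. The windows `[−a,a]` / `(−a,a)` differ by a null set.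
  `⟨φ₁,φ₂⟩_{G_g,a} = ⟨𝖦_g[a]φ₁, φ₂⟩_{L²}` (p0007:L17, §5 p0015): `zetaScrewForm_eq_integral_zetaScrewOp`.
* `I_b^{(a)}φ(t) := ∫_{−a}^{t} φ(u) du + b` (p0007:L99) — `screwPrimitive a b φ`; (3.7) p0007:L107:
  `D : C(a) → 𝔈₀(a)` and `I₀^{(a)} : 𝔈₀(a) → C(a)` are inverse bijections (RH-FREE; proved in the
  sibling `…Proofs.lean`, not vendored as a fact).
* Thm. 1.3 p0003:L56 — `Suzuki2023_thm13` (the `iff`, AS PRINTED: non-negativity on `𝔈₀(a)` for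
  every `0 < a < ∞`) and `Suzuki2023_thm13_posdef` (the "Moreover, assuming RH" clause: strict
  positivity on `L²(−a,a) ∖ {0}` — an RH-CONSEQUENCE, explicit `RiemannHypothesis →` binder).
  Non-negativity `⟨φ,φ⟩ ≥ 0` of a complex number is typed in the order of `ℂ`
  (`0 ≤ z ↔ 0 ≤ Re z ∧ Im z = 0`), as the tree types (1.5) (`IsPosSemidefKernelOn`).
* Thm. 1.4 p0003:L78 — `IsScrewFormNondegenerate a` ("non-degenerate on `L²(−a,a)`":
  `(∀ φ₂, ⟨φ₁,φ₂⟩ = 0) → φ₁ = 0`), `Suzuki2023_thm14` (the `iff`), `Suzuki2023_thm14_eigenvalue`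
  ("the latter condition is equivalent that `𝖦_g[a]` does not have zero as an eigenvalue", i.e.
  `𝖦_g[a]φ = 0 ⟹ φ = 0` on `L²(−a,a)`; RH-FREE).
* Thm. 1.5 p0003:L108 (trace class) and the trace formula p0003:L112–118: sibling module
  `ZetaScrewTraceClass.lean` (`Suzuki2023_thm15`, `Suzuki2023_thm15_trace`), over `zetaScrewOp`.
* Lemma 2.1 p0006:L171 — `Suzuki2023_lemma21` (an entire function of exponential type constant on
  the zeros of `ξ(1/2 − iz)` is constant; "exponential type" inlined as `‖F z‖ ≤ C e^{R‖z‖}` as in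
  `Literature/Analysis/Complex/ExpTypeIndicator.lean`; the zeros typed literally as
  `riemannXi (1/2 − I γ) = 0`, `riemannXi` = Suzuki's `ξ`).
* (3.3) p0007:L66: the Weil distribution `W(ψ) := Σ_γ ψ̂(γ)`, `ψ̂(z) = ∫ ψ(t) e^{izt} dt`
  (p0007:L8). DICTIONARY: `γ = i(ρ − 1/2)` for `ρ` a non-trivial zero of `ζ`, so
  `ψ̂(γ) = ∫ ψ(t) e^{−(ρ−1/2)t} dt = weilMellin ψ (1 − ρ)`, and by the symmetry `ρ ↦ 1 − ρ` of the
  zero multiset `Σ_γ ψ̂(γ) = Σ_ρ m(ρ) weilMellin ψ ρ` = the ZERO SIDE of the tree's explicit formula,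
  summed symmetrically (`HasWeilZeroSide ψ Z`). Hence Prop. 3.1 p0007:L119,
  `⟨Dψ₁, Dψ₂⟩_{G_g,a} = W(ψ₁ ∗ ψ̃₂)` for `ψ₁, ψ₂ ∈ C(a)` (`ψ̃(x) = conj ψ(−x)` = `weilReflect`,
  `∗` = `weilConv`, (3.5)), is typed as
  `HasWeilZeroSide (weilConv ψ₁ (weilReflect ψ₂)) (zetaScrewForm (Ioo (−a) a) (deriv ψ₁) (deriv ψ₂))`
  — `Suzuki2023_prop31`. By `explicit_formula_holds` the zero side of a test function equals
  `weilFunctional`, so the diagonal case reads `weilQuadratic ψ = ⟨ψ′,ψ′⟩_{G_g,a}`: this is (up to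
  writing the window as `ℝ²`, immaterial for `supp ψ ⊆ [−a,a]`) the route item
  `Summit.RiemannHypothesis.RiemannHypothesis.Theses.PluckedString.PsiWeilIdentity`
  (stmt-RiemannHypothesis-2623), which a discharge of `Suzuki2023_prop31` closes Summits-side.
  The companion paper arXiv:2209.04658 cites this identity as its (1.17)
  ("`⟨Dψ₁,Dψ₂⟩_{G_g} = ⟨ψ₁,ψ₂⟩_W` … in [Su22, Proposition 3.1]").

## Already in the tree (CITED, not restated)

Prop. 2.1 p0005:L172 (`φ(t) = 4e^{t/2} + O(e^{t/2−c√t})`) is PROVED: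
`Literature.NumberTheory.LFunctions.Suzuki2023_prop21` (`ZetaScrewProofs.lean`). Thm. 1.2 (RH ⟺
`G_g` non-negative definite on `ℝ`) is `Suzuki2023_thm12` with `Suzuki2023_thm12_holds`; Thm. 1.1
(1)–(3) are `Suzuki2023_thm11_{fourier,series,growth}` (all `_holds`); Thm. 1.7 `Suzuki2023_thm17_holds`;
Thm. 4.2's screw clause `Suzuki2023_thm42_screw_holds`. Weil's/Yoshida's criterion:
`riemannHypothesis_iff_forall_weilPositivityOn` (`UniformWeilPositivityRH.lean`).

## Deliberately NOT here

Thm. 1.5 and the trace formula (`ZetaScrewTraceClass.lean`); Thms. 1.6, 1.8, 4.3, 6.1, 8.1, 8.2,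
11.1 (module `ZetaScrewGrowthMoments.lean` of this corpus);
§4.2 Yoshida's results (COLUMN 2); the proofs (sibling `ZetaScrewHermitianFormsProofs.lean`:
the bijection (3.7), `⟨φ,φ⟩_{G_g,a} ≥ 0` under RH from `Suzuki2023_thm12_holds`, the reduction
"Prop. 3.1 + non-negativity on every `𝔈₀(a)` ⟹ RH" through `riemannHypothesis_iff_forall_weilPositivityOn`,
and `Suzuki2023_thm14_eigenvalue`). No Kreĭn class `𝒢_a` for general `g` (definition request
`KreinString`, `Literature/Analysis/InverseSpectral`).
-/

noncomputable section

open MeasureTheory Set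
open scoped ComplexConjugate ComplexOrder

namespace Literature.NumberTheory.LFunctions

/-! ## The objects (1.10), (1.11), (1.12), (3.6), `I_b^{(a)}` -/

/-- Suzuki's hermitian form (1.10) attached to the screw function `g = −Ψ` of `ζ`, with the
integration window a set `S ⊆ ℝ`:
`⟨φ₁,φ₂⟩_{G_g,S} := ∫_S ∫_S G_g(t,u) φ₁(u) conj(φ₂(t)) du dt`, `G_g = zetaScrewKernel`
(`= Ψ(t) + Ψ(u) − Ψ(t−u)`). The printed `⟨·,·⟩_{G_g,a}` (`0 < a < ∞`) is `S = Ioo (−a) a`; the form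
`⟨·,·⟩_{G_g}` on `C_c^∞(ℝ)` of arXiv:2209.04658 (1.15) is `S = univ`. Bochner integrals (junk `0`
if divergent; the source defines the form "when the right-hand side is absolutely convergent").
[cite: Suzuki2023, §1 eq. (1.10), p. 3 (held text p0003:L38–44)] -/
def zetaScrewForm (S : Set ℝ) (φ₁ φ₂ : ℝ → ℂ) : ℂ :=
  ∫ t in S, ∫ u in S, (zetaScrewKernel t u : ℂ) * φ₁ u * conj (φ₂ t)

/-- The test class `C(a) := {ψ ∈ C_c^∞(ℝ) : supp ψ ⊆ [−a,a]}` of (3.6) (smooth = `ContDiff ℝ ∞`,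
compact support: the tree's `IsWeilTest`; support = `tsupport`). This is literally the class over
which `WeilPositivityOn a` quantifies. [cite: Suzuki2023, §3.3 eq. (3.6), p. 7 (held text p0007:L95)] -/
def screwTestC (a : ℝ) : Set (ℝ → ℂ) :=
  {ψ | IsWeilTest ψ ∧ tsupport ψ ⊆ Icc (-a) a}

/-- The space `𝔈₀(a) := {φ ∈ C_c^∞(ℝ) : supp φ ⊆ [−a,a], ∫_{−a}^{a} φ(t) dt = 0}` of (1.11)
(mean-zero smooth functions supported in `[−a,a]`; the mean is written over `ℝ`, which equals
`∫_{−a}^{a}` for such `φ`). "Note that `𝔈₀(a)` is not the class of continuous functions on `(−a,a)`." [cite: Suzuki2023, §1 eq. (1.11), p. 3 (held text p0003:L48)] -/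
def screwTestC0 (a : ℝ) : Set (ℝ → ℂ) :=
  {φ | IsWeilTest φ ∧ tsupport φ ⊆ Icc (-a) a ∧ ∫ t, φ t = 0}

/-- The integral operator (1.12) at the level of functions, with window a set `S`:
`(𝖦_g[S]φ)(t) := 𝟏_S(t) ∫_S G_g(t,u) φ(u) du`. The printed `𝖦_g[a] : L²(−a,a) → L²(−a,a)` is
`S = Ioo (−a) a` applied to (representatives of) elements of `Lp ℂ 2 (volume.restrict (Ioo (−a) a))`
(the printed indicator is `𝟏_{[−a,a]}`; `[−a,a] ∖ (−a,a)` is Lebesgue-null). [cite: Suzuki2023, Thm 1.4 eq. (1.12), p. 3 (held text p0003:L83–86)] -/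
def zetaScrewOp (S : Set ℝ) (φ : ℝ → ℂ) (t : ℝ) : ℂ :=
  S.indicator (fun t ↦ ∫ u in S, (zetaScrewKernel t u : ℂ) * φ u) t

/-- The primitive `(I_b^{(a)}φ)(t) := ∫_{−a}^{t} φ(u) du + b` (`b ∈ ℂ`) of §3.3; `I₀^{(a)}` inverts
`D = d/dt` between `C(a)` and `𝔈₀(a)` ((3.7), proved in the sibling proofs module). [cite: Suzuki2023, §3.3 (definition of I_b^{(a)}), p. 7 (held text p0007:L99)] -/
def screwPrimitive (a : ℝ) (b : ℂ) (φ : ℝ → ℂ) (t : ℝ) : ℂ :=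
  (∫ u in (-a)..t, φ u) + b

/-- `𝔈₀(a) ⊆ C(a)` (drop the mean-zero condition). [cite: Suzuki2023, §3.3 eq. (3.6)–(3.7), p. 7] -/
theorem screwTestC0_subset_screwTestC (a : ℝ) : screwTestC0 a ⊆ screwTestC a :=
  fun _ h ↦ ⟨h.1, h.2.1⟩

/-- Outside the window the operator (1.12) vanishes (the indicator `𝟏_S`). [cite: Suzuki2023, Thm 1.4 eq. (1.12), p. 3] -/
theorem zetaScrewOp_apply_of_not_mem {S : Set ℝ} {t : ℝ} (ht : t ∉ S) (φ : ℝ → ℂ) :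
    zetaScrewOp S φ t = 0 :=
  Set.indicator_of_notMem ht _

/-- Inside the window, `(𝖦_g[S]φ)(t) = ∫_S G_g(t,u) φ(u) du`. [cite: Suzuki2023, Thm 1.4 eq. (1.12), p. 3] -/
theorem zetaScrewOp_apply_of_mem {S : Set ℝ} {t : ℝ} (ht : t ∈ S) (φ : ℝ → ℂ) :
    zetaScrewOp S φ t = ∫ u in S, (zetaScrewKernel t u : ℂ) * φ u :=
  Set.indicator_of_mem ht _

/-- `⟨φ₁,φ₂⟩_{G_g,a} = ⟨𝖦_g[a]φ₁, φ₂⟩_{L²(−a,a)}`: the form is the `L²` pairing against the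
integral operator (p0007:L17; §5, p0015: "since `⟨φ₁,φ₂⟩_{G_g,a} = ⟨𝖦_g[a]φ₁,φ₂⟩_{L²}`").
Definitional up to pulling the constant `conj φ₂(t)` out of the inner integral; valid for any
measurable window. [cite: Suzuki2023, §3.1 p. 7 (held text p0007:L17) and §5 p. 15] -/
theorem zetaScrewForm_eq_integral_zetaScrewOp {S : Set ℝ} (hS : MeasurableSet S)
    (φ₁ φ₂ : ℝ → ℂ) :
    zetaScrewForm S φ₁ φ₂ = ∫ t in S, zetaScrewOp S φ₁ t * conj (φ₂ t) := by
  unfold zetaScrewForm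
  refine setIntegral_congr_fun hS fun t ht ↦ ?_
  rw [zetaScrewOp_apply_of_mem ht, ← integral_mul_const]

/-! ## Named facts (statements as printed; users take `(h : …)`) -/

/-- RH-FREE. **Suzuki2023 Lemma 2.1.** Let `F` be an entire function of exponential type
(`‖F(z)‖ ≤ C e^{R|z|}`) and `A ∈ ℂ`. If `F(γ) = A` for all zeros `γ` of `ξ(1/2 − iz)`, then `F ≡ A`.
(Printed proof: the zeros of `F − A` in `|z| ≤ r` are `O(r)`, while the distinct zeros of
`ξ(1/2 − z)` in `|z| ≤ r` are not `O(r)` — Titchmarsh §9.12 / Littlewood; alternatively Conrey's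
proportion of simple critical zeros.) `ξ` = `riemannXi`. [cite: Suzuki2023, Lemma 2.1, p. 6 (held text p0006:L171–175)] -/
def Suzuki2023_lemma21 : Prop :=
  ∀ F : ℂ → ℂ, Differentiable ℂ F →
    (∃ C R : ℝ, ∀ z : ℂ, ‖F z‖ ≤ C * Real.exp (R * ‖z‖)) →
      ∀ A : ℂ, (∀ γ : ℂ, riemannXi (1 / 2 - Complex.I * γ) = 0 → F γ = A) → ∀ z : ℂ, F z = A

/-- RH-EQUIVALENT (line 1; both directions printed and proved in the source: necessity §3.1 from
Thm. 1.2, sufficiency §3.3 from Weil's positivity criterion via Prop. 3.1 and the bijection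
`D : C(a) → 𝔈₀(a)` — i.e. this is `riemannHypothesis_iff_forall_weilPositivityOn` RE-INDEXED by `D`;
COLUMN 2 owns the positivity, nothing is asserted here). **Suzuki2023 Thm. 1.3 (main clause).**
"The RH is true if and only if the hermitian form `⟨·,·⟩_{G_g,a}` is non-negative definite on
`𝔈₀(a)`, that is, `⟨φ,φ⟩_{G_g,a} ≥ 0` for all `φ ∈ 𝔈₀(a)` for every `0 < a < ∞`."
Non-negativity in the order of `ℂ`. [cite: Suzuki2023, Thm 1.3, p. 3 (held text p0003:L56–61)] -/
def Suzuki2023_thm13 : Prop :=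
  RiemannHypothesis ↔
    ∀ a : ℝ, 0 < a → ∀ φ ∈ screwTestC0 a, 0 ≤ zetaScrewForm (Ioo (-a) a) φ φ

/-- RH-CONSEQUENCE (printed "assuming that the RH is true"; explicit `RiemannHypothesis →` binder,
never dropped). **Suzuki2023 Thm. 1.3 ("Moreover" clause).** Under RH, `⟨·,·⟩_{G_g,a}` is positive
definite on `L²(−a,a)`: `⟨φ,φ⟩_{G_g,a} > 0` for all non-zero `φ ∈ L²(−a,a)`, for every
`0 < a < ∞` (printed proof: (3.1)–(3.2) and Lemma 2.1). `L²(−a,a)` = `Lp ℂ 2 (volume.restrict (Ioo (−a) a))`;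
strict positivity in the order of `ℂ`. [cite: Suzuki2023, Thm 1.3 (moreover clause), p. 3 (held text p0003:L62–67)] -/
def Suzuki2023_thm13_posdef : Prop :=
  RiemannHypothesis →
    ∀ a : ℝ, 0 < a → ∀ φ : Lp ℂ 2 (volume.restrict (Ioo (-a) a)), φ ≠ 0 →
      0 < zetaScrewForm (Ioo (-a) a) φ φ

/-- "The hermitian form `⟨·,·⟩_{G_g,a}` is non-degenerate on `L²(−a,a)`": an element of `L²(−a,a)`
pairing to `0` with every element of `L²(−a,a)` is `0` (Thm. 1.4, p0003:L78–81; §5 p. 15).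
RH-FREE predicate (nothing asserted). [cite: Suzuki2023, Thm 1.4, p. 3 (held text p0003:L78–81)] -/
def IsScrewFormNondegenerate (a : ℝ) : Prop :=
  ∀ φ₁ : Lp ℂ 2 (volume.restrict (Ioo (-a) a)),
    (∀ φ₂ : Lp ℂ 2 (volume.restrict (Ioo (-a) a)), zetaScrewForm (Ioo (-a) a) φ₁ φ₂ = 0) → φ₁ = 0

/-- RH-EQUIVALENT (line 1; both directions printed and proved: necessity §5.1 via Thm. 1.2, (3.1),
(3.2), Lemma 2.1; sufficiency §5.2–5.3 in Yoshida's strategy via Thms. 1.3 and 4.3 — Yoshida's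
non-degeneracy criterion RE-INDEXED by `D`, COLUMN 2; nothing asserted here).
**Suzuki2023 Thm. 1.4 (first sentence).** "The RH is true if and only if the hermitian form
`⟨·,·⟩_{G_g,a}` is non-degenerate on `L²(−a,a)` for every `0 < a < ∞`." [cite: Suzuki2023, Thm 1.4, p. 3 (held text p0003:L78–81)] -/
def Suzuki2023_thm14 : Prop :=
  RiemannHypothesis ↔ ∀ a : ℝ, 0 < a → IsScrewFormNondegenerate a

/-- RH-FREE. **Suzuki2023 Thm. 1.4 (second sentence).** "The latter condition is equivalent that the
integral operator `𝖦_g[a] : L²(−a,a) → L²(−a,a)`, `φ(t) ↦ 𝟏_{[−a,a]}(t) ∫_{−a}^{a} G_g(t,u) φ(u) du`,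
does not have zero as an eigenvalue for every `0 < a < ∞`" — typed window by window:
non-degeneracy on `L²(−a,a)` iff `𝖦_g[a]φ = 0` (a.e. on `(−a,a)`) only for `φ = 0`
(printed reason, §5 p. 15: `⟨φ₁,φ₂⟩_{G_g,a} = ⟨𝖦_g[a]φ₁,φ₂⟩_{L²}` for the self-adjoint
Hilbert–Schmidt operator `𝖦_g[a]`). [cite: Suzuki2023, Thm 1.4 (second sentence), p. 3 (held text p0003:L81–88)] -/
def Suzuki2023_thm14_eigenvalue : Prop :=
  ∀ a : ℝ, 0 < a →
    (IsScrewFormNondegenerate a ↔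
      ∀ φ : Lp ℂ 2 (volume.restrict (Ioo (-a) a)),
        zetaScrewOp (Ioo (-a) a) φ =ᵐ[volume.restrict (Ioo (-a) a)] 0 → φ = 0)

/-- RH-FREE. **Suzuki2023 Prop. 3.1.** "Let `0 < a < ∞` and let `C(a)` be the space defined in (3.6).
Then `⟨Dψ₁, Dψ₂⟩_{G_g,a} = W(ψ₁ ∗ ψ̃₂)` for every `ψ₁, ψ₂ ∈ C(a)`", where `D = d/dt`,
`(ψ₁ ∗ ψ₂)(x) = ∫ ψ₁(y)ψ₂(x−y) dy`, `ψ̃(x) = conj ψ(−x)` ((3.5): the tree's `weilConv`, `weilReflect`)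
and `W(ψ) := Σ_γ ψ̂(γ)` is the Weil distribution (3.3), `ψ̂(z) = ∫ ψ(t)e^{izt} dt`. In the tree's
coordinates (`γ = i(ρ − 1/2)`, `ψ̂(γ) = weilMellin ψ (1 − ρ)`, zero multiset symmetric under
`ρ ↦ 1 − ρ`) `W(ψ)` is the symmetric zero-side sum `lim_T Σ_{|Im ρ| ≤ T} m(ρ) ψ̂(ρ)` of the explicit
formula, `HasWeilZeroSide ψ (W ψ)`; so the identity says: the zero side of `ψ₁ ∗ ψ̃₂` converges to
`⟨ψ₁′, ψ₂′⟩_{G_g,a}`. With `explicit_formula_holds` (zero side of a test function = `weilFunctional`)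
the diagonal case is `weilQuadratic ψ = ⟨ψ′,ψ′⟩_{G_g,a}` = route item `PsiWeilIdentity`
(stmt-RiemannHypothesis-2623) of `PluckedString`; cited as (1.17) of arXiv:2209.04658. Printed proof:
integration by parts in (3.1). [cite: Suzuki2023, Prop 3.1, p. 7 (held text p0007:L119–126)] -/
def Suzuki2023_prop31 : Prop :=
  ∀ a : ℝ, 0 < a → ∀ ψ₁ ∈ screwTestC a, ∀ ψ₂ ∈ screwTestC a,
    HasWeilZeroSide (weilConv ψ₁ (weilReflect ψ₂))
      (zetaScrewForm (Ioo (-a) a) (deriv ψ₁) (deriv ψ₂))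

end Literature.NumberTheory.LFunctions

end
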